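import Summits.ABC.IUTFork.Cor312LicenceExactOrdersMRational
import Summits.ABC.IUTFork.Cor312LicenceWildInhabitedRealising
import Literature.IUT.LogVolume.DifferentOrdDivisor
import Literature.IUT.LogVolume.HullVolumeAssembly
import HarnessLib

/-!
# Branch C / R-W, reading (U), M line: the (xi-f) licence at the M-LEVEL setting of the datum's OWN ideles from ONE-SIDED per-prime
# integers — the M twin of abc-iut-W-row-1's K-level orders socket (abc-iut cell, branch C, row «C:COR312U-EVENTUAL-M», file A = the
# socket; seat abc-iut-C-cert-2 gen 7; C-lead ruling C-R108 (b))

Record-only PROOF file (D-0012; 0 definitions, 0 `Prop` facts, nothing re-typed) of the abc-iut cell. TAKES NO SIDE on [IUTchIII] Cor. 3.12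
(S. Mochizuki, *Inter-universal Teichmüller theory III*, Cor. 3.12 p. 173–174; Step (xi-f) p. 184) or on any author; «inhabited as typed» ≠
«asserted in print».

THE SOCKET. abc-iut-w5-d166's `licence_settingPrVolSharpM_tOfIdeleData_iff_orders_of_j_mem_range` (`Cor312LicenceExactOrdersMRational`)
DECIDES the licence of the M books' setting `settingPrVolSharpM D … (tOfIdeleData D r) (tqM … r) …` (initial Θ-data `D` with RATIONAL
`j`-invariant, hence one member of `V̲` over each rational prime) EXACTLY, in terms of EXACT local data at the member `x₀(u)`: a norm
uniformizer `ϖ_u`, the different exponent `D_u` (`d = D_u/e_u`), abc-iut-c312-5's inner/outer shell radii `cin(u) = ϖ_u^{R_in(u)}·(unit)`,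
`cout(u)` (`‖cout(u)‖ = ‖ϖ_u‖^{R_out(u)}`) and the integer `m_q(u)` (`‖t_{q,x₀(u)}‖ = ‖ϖ_u‖^{m_q(u)}`). THIS FILE supplies those exact
witnesses BY NAME and weakens the test to ONE-SIDED inputs, exactly as abc-iut-W-row-1 did on the K line
(`Cor312LicenceWildInhabitedRealising` / `…GenuineK`: `licence_settingPrVolSharp_pilotDataOfK_of_orders_rat`):

* the radii EXIST in every `K_{v̲} = kOfM …` — W-row-1's GENERIC `exists_shellRadii_binders` (any proper ultrametric normed `ℚ_p`-field:
  `log_p(𝒪^×)` is compact open; `cin = ϖ^{n₀}` for the least admissible `n₀`, `cout` a log-unit of largest norm) — and every inner radius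
  lies below any NON-member of `log_p(𝒪^×)` (`norm_inner_le_of_not_mem`), every outer radius above any MEMBER (`hdom`);
* the exponents exist because `‖·‖` takes values in `‖ϖ‖^ℤ` (`IsUniformizer`); `d(K_{v̲}) = ord_{v̲}(𝔇)/e(v̲|p)` (`differentOrd_rescaledCompletion`);
* the exact predicate `e·⌊((i+1)²m_q − (i+1)D − (i+2)R_in)/e⌋ + (i+2)R_out ≤ m_q` is MONOTONE: it follows from the same inequality with
  any `D' ≤ D`, `ρ_in ≤ R_in`, `ρ_out ≥ R_out`; at a member off `V^bad_mod` (`‖t_q‖ = 1`, `m_q = 0`) it is automatic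
  (abc-iut-w5-d166 `orders_predicate_of_exponents_zero`, `radius_exponent_le_of_witnesses`).

* **`WRowM.licence_tOfIdeleData_of_orders_rat`** — `j_E ∈ ℚ`; per rational place `u` integers `e_u, D_u, P_u ∈ ℕ`, `ρin_u, ρout_u ∈ ℤ`; IF
  at every member `x` of `V̲_u` lying over `V^bad_mod`: `e(K_x/ℚ_p) = e_u`, `D_u/e_u ≤ d(K_x)`, some `z ∉ log_p(𝒪^×_{K_x})` has
  `‖z‖ ≤ p^{−(ρin_u−1)/e_u}`, some member has norm `≥ p^{−ρout_u/e_u}`, and `‖t_{q,x}‖ = p^{−P_u/e_u}`; and IF the integer cell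
  `e_u·⌊((i+1)²P_u − (i+1)D_u − (i+2)ρin_u)/e_u⌋ + (i+2)ρout_u ≤ P_u` holds at every label whenever `V̲_u` meets `V^bad_mod` — THEN
  `Thm311ToCor312.Licence` holds at the M books' setting (ANY context / column data, ANY `htq0`/`Sq`/`htq1` bookkeeping).

READING (neutral): the M-line twin of the K socket; consumed by file B (the all-triples sharp eventual M licence). HONEST SCOPE: OUR sharp
containers and Dupuy–Hilado's typed (Ind1)/(Ind2); the licence is a STRONGER-THAN-PRINT set-level reading of Step (xi-f); nothing about the
printed GLOBAL inequality or the NUMBER-level corollary; existence of initial Θ-data at any given curve is NOT claimed; typed ≠ proved;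
instantiated ≠ endorsed; no abc claim. [cite: Mochizuki2012, IUTchI Def. 3.1 (b),(e) pp. 61–62, Ex. 3.2 (iv) p. 71; IUTchIII Cor. 3.12
p. 173–174, Step (xi-f) p. 184; IUTchIV Prop. 1.1 p. 9, Prop. 1.2 (i)(ii) p. 10] [cite: DupuyHilado2025, §3.3, §3.4, §3.9, §4.9, §4.12]
[cite: NeukirchANT1999, Ch. II (5.5)] [claim: Mochizuki2012, status: disputed] for every IUT sentence. PROOF-ONLY: no definitions.
-/

noncomputable section

open Set Function NumberField IsDedekindDomain
open scoped Pointwise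

namespace Summit.ABC.IUTFork.Conditional

open Thm311 Thm311.Real Cor312 Cor312Vol Literature.IUT.LogThetaLattice Literature.IUT.LogVolume Literature.IUT.HodgeTheaters
  Literature.NumberTheory.NumberFields Literature.NumberTheory.GaloisRepresentations.Ultrametric

section Own

variable {F K Fbar : Type} [Field F] [NumberField F] [Field K] [NumberField K] [Algebra F K]
  [Field Fbar] [Algebra F Fbar] [Algebra K Fbar] {E : WeierstrassCurve F} [E.IsElliptic] {l : ℕ}
  {Pb : BadPlacePredicates K} (D : InitialThetaData F K Fbar E l Pb) {logvK : PadicLogsVal K}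
  (hlog : LogvAnalyticVal logvK) (r : ThetaData.IdeleData D)
  (M : Type) [Field M] [NumberField M]
  (archPk : ∀ (j : (thetaIndexOfInitial D).Label) (vQ : (thetaIndexOfInitial D).VQ),
    Set ((logShellsOfInitialDH D logvK).Packet j vQ))
  (archSub : ∀ (j : (thetaIndexOfInitial D).Label) (v : (thetaIndexOfInitial D).V),
    Set ((logShellsOfInitialDH D logvK).Packet j ((thetaIndexOfInitial D).over v)))
  (Ψ : ℤ → ∀ v : (thetaIndexOfInitial D).V, v ∈ (thetaIndexOfInitial D).Vbad →
    Set ((logShellsOfInitialDH D logvK).StarPacket v))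
  (act : ℤ → ∀ v : (thetaIndexOfInitial D).V, v ∈ (thetaIndexOfInitial D).Vbad →
    (logShellsOfInitialDH D logvK).StarPacket v → Module.End ℚ ((logShellsOfInitialDH D logvK).StarPacket v))
  (Mmod : ℤ → ∀ j : (thetaIndexOfInitial D).LabelStar, Set ((logShellsOfInitialDH D logvK).GlobalPacket j.1))
  (region : ℤ → ∀ j : (thetaIndexOfInitial D).LabelStar, FinDivisor M → ∀ vQ : (thetaIndexOfInitial D).VQ,
    Set ((logShellsOfInitialDH D logvK).Packet j.1 vQ))
  (n : ℤ) {HT : Type} {LogLink : HT → HT → Type} {IsFull : ∀ {s t : HT}, LogLink s t → Prop}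
  (lat : LGPGaussianLogThetaLattice LogLink IsFull)
  {Frd : Type} {IsoF : Frd → Frd → Type} {Ob : Frd → Type} {realify : Frd → Frd} {Strip : Type}
  {IsoS : Strip → Strip → Type}
  {Mv : ∀ v : (thetaIndexOfInitial D).V, v ∈ (thetaIndexOfInitial D).Vbad → Type} [∀ v h, Monoid (Mv v h)]
  (sig : GlobalLGPFrobenioidSignature (thetaIndexOfInitial D).lstar (thetaIndexOfInitial D).V
    (· ∈ (thetaIndexOfInitial D).Vbad) Frd IsoF Ob realify Strip IsoS Mv)
  (split : SplittingMonoids Mv) {ObΔ : Type}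
  {N : ∀ v : (thetaIndexOfInitial D).V, v ∈ (thetaIndexOfInitial D).Vbad → Type} [∀ v h, Monoid (N v h)]
  (qData : QPilotData ObΔ N)
  (htq0 : ∀ (u : FinitePlace ℚ) (x : (thetaIndexOfInitial D).Fibre (Val.non u)),
    tqM D (ratChar u) u (natCast_ratChar_mem u) r x ≠ 0)
  (Sq : Finset (FinitePlace ℚ))
  (htq1 : ∀ (u : FinitePlace ℚ) (x : (thetaIndexOfInitial D).Fibre (Val.non u)), u ∉ Sq →
    ‖tqM D (ratChar u) u (natCast_ratChar_mem u) r x‖ = 1)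

/-- **THE (xi-f) LICENCE AT THE M-LEVEL SETTING OF THE OWN IDELES, FROM ONE-SIDED PER-PRIME INTEGERS** (rational `j`-invariant).
Per rational place `u`: `e_u, D_u, P_u ∈ ℕ`, `ρin_u, ρout_u ∈ ℤ`. IF every member `x ∈ V̲_u` over `V^bad_mod` has `e(K_x/ℚ_p) = e_u`,
`D_u/e_u ≤ d(K_x)`, a NON-member `z ∉ log_p(𝒪^×_{K_x})` with `‖z‖ ≤ p^{−(ρin_u−1)/e_u}`, a MEMBER `z'` with `‖z'‖ ≥ p^{−ρout_u/e_u}`, and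
`‖t_{q,x}‖ = p^{−P_u/e_u}`; and IF, whenever `V̲_u` meets `V^bad_mod`, `e_u·⌊((i+1)²P_u − (i+1)D_u − (i+2)ρin_u)/e_u⌋ + (i+2)ρout_u ≤ P_u`
at every label `i+1 ≤ l⋆` — THEN `Thm311ToCor312.Licence` at `settingPrVolSharpM D … (tOfIdeleData D r) (tqM … r) …`. Proof: the exact
decider of abc-iut-w5-d166 fed with W-row-1's generic radii (`exists_shellRadii_binders`), norm-uniformizer exponents and
`differentOrd_rescaledCompletion`; monotonicity of the cell; good members by `orders_predicate_of_exponents_zero`.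
[cite: Mochizuki2012, IUTchI Def. 3.1 (b),(e) pp. 61–62; IUTchIII Cor. 3.12 Step (xi-f) p. 184; IUTchIV Prop. 1.1 p. 9, Prop. 1.2 (i)(ii) p. 10]
[cite: DupuyHilado2025, §3.3, §3.4, §4.9, §4.12] [cite: NeukirchANT1999, Ch. II (5.5)] [claim: Mochizuki2012, status: disputed] -/
theorem WRowM.licence_tOfIdeleData_of_orders_rat (hj : E.j ∈ Set.range (algebraMap ℚ F))
    (e Dd P : FinitePlace ℚ → ℕ) (ρin ρout : FinitePlace ℚ → ℤ)
    (hloc : ∀ (u : FinitePlace ℚ) (x : (thetaIndexOfInitial D).Fibre (Val.non u)),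
      placeModOfM D u x ∈ (ThetaData.pilotData D).S →
        absRamificationIdx (ratChar u) (kOfM D (ratChar u) u (natCast_ratChar_mem u) x) = e u ∧
        (Dd u : ℝ) / (e u : ℝ) ≤ differentOrd (ratChar u) (kOfM D (ratChar u) u (natCast_ratChar_mem u) x) ∧
        (∃ z : kOfM D (ratChar u) u (natCast_ratChar_mem u) x,
          z ∉ logUnits (kOfM D (ratChar u) u (natCast_ratChar_mem u) x) ∧
          ‖z‖ ≤ ((ratChar u : ℕ) : ℝ) ^ (-(((ρin u : ℝ) - 1) / (e u : ℝ)))) ∧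
        (∃ z ∈ logUnits (kOfM D (ratChar u) u (natCast_ratChar_mem u) x),
          ((ratChar u : ℕ) : ℝ) ^ (-((ρout u : ℝ) / (e u : ℝ))) ≤ ‖z‖) ∧
        ‖tqM D (ratChar u) u (natCast_ratChar_mem u) r x‖ = ((ratChar u : ℕ) : ℝ) ^ (-((P u : ℝ) / (e u : ℝ))))
    (hcell : ∀ u : FinitePlace ℚ,
      (∃ x : (thetaIndexOfInitial D).Fibre (Val.non u), placeModOfM D u x ∈ (ThetaData.pilotData D).S) →
      ∀ i : Fin (thetaIndexOfInitial D).lstar,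
        (e u : ℤ) * (((((i : ℕ) + 1 : ℕ) : ℤ) ^ 2 * (P u : ℤ) - (((i : ℕ) + 1 : ℕ) : ℤ) * (Dd u : ℤ) -
            (((i : ℕ) + 2 : ℕ) : ℤ) * ρin u) / (e u : ℤ)) + (((i : ℕ) + 2 : ℕ) : ℤ) * ρout u ≤ (P u : ℤ)) :
    Thm311ToCor312.Licence
      (settingPrVolSharpM D hlog (tOfIdeleData D r) (fun u x => tqM D (ratChar u) u (natCast_ratChar_mem u) r x) M archPk archSub
        Ψ act Mmod region n lat sig split qData htq0 Sq htq1) := by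
  classical
  -- one member over each rational place (a number field has a place over every prime; `V̲_u ≅ V(F_mod)_p`)
  have hne : ∀ u : FinitePlace ℚ, Nonempty ((thetaIndexOfInitial D).Fibre (Val.non u)) := fun u =>
    ⟨(fibreEquivPlacesOverM D (ratChar u) u (natCast_ratChar_mem u)).symm
      (Classical.choice (nonempty_placesOver (F := ↥(fieldOfModuli E)) (ratChar u)))⟩
  let x₀ : ∀ u : FinitePlace ℚ, (thetaIndexOfInitial D).Fibre (Val.non u) := fun u => Classical.choice (hne u)
  -- norm uniformizers
  have hϖex : ∀ u : FinitePlace ℚ, ∃ ϖ : (kOfM D (ratChar u) u (natCast_ratChar_mem u) (x₀ u))ˣ, IsUniformizer ϖ :=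
    fun u => exists_isUniformizer
  choose ϖ hϖ using hϖex
  -- abc-iut-c312-5's radii, by W-row-1's generic existence theorem
  have hrad := fun u : FinitePlace ℚ => exists_shellRadii_binders (ratChar u) (kOfM D (ratChar u) u (natCast_ratChar_mem u) (x₀ u))
  choose cin cout hin0 hin hmax hout0 houtΛ hdom using hrad
  -- integer exponents of the radii and of the q-idele
  have hRinex : ∀ u, ∃ k : ℤ, ‖cin u‖ = ‖(ϖ u : kOfM D (ratChar u) u (natCast_ratChar_mem u) (x₀ u))‖ ^ k := fun u => by
    obtain ⟨k, hk⟩ := (hϖ u).2 (Units.mk0 (cin u) (hin0 u)); exact ⟨k, by simpa using hk⟩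
  choose Rin hRin using hRinex
  have hRoutex : ∀ u, ∃ k : ℤ, ‖cout u‖ = ‖(ϖ u : kOfM D (ratChar u) u (natCast_ratChar_mem u) (x₀ u))‖ ^ k := fun u => by
    obtain ⟨k, hk⟩ := (hϖ u).2 (Units.mk0 (cout u) (hout0 u)); exact ⟨k, by simpa using hk⟩
  choose Rout hRout using hRoutex
  have hmqex : ∀ u, ∃ k : ℤ, ‖tqM D (ratChar u) u (natCast_ratChar_mem u) r (x₀ u)‖ =
      ‖(ϖ u : kOfM D (ratChar u) u (natCast_ratChar_mem u) (x₀ u))‖ ^ k := fun u => by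
    obtain ⟨k, hk⟩ := (hϖ u).2 (Units.mk0 _ (tqM_ne_zero D (ratChar u) u (natCast_ratChar_mem u) r (x₀ u)))
    exact ⟨k, by simpa using hk⟩
  choose mq hq using hmqex
  -- the different exponent `D_u = ord_{v̲}(𝔇_{K/ℤ})`
  let Dx : FinitePlace ℚ → ℕ := fun u => multiplicity (placeOfM D u (x₀ u)).asIdeal (differentIdeal ℤ (𝓞 K))
  have hD : ∀ u, differentOrd (ratChar u) (kOfM D (ratChar u) u (natCast_ratChar_mem u) (x₀ u)) =
      (Dx u : ℝ) / absRamificationIdx (ratChar u) (kOfM D (ratChar u) u (natCast_ratChar_mem u) (x₀ u)) := fun u => by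
    rw [absRamificationIdx_rescaledCompletion]
    exact differentOrd_rescaledCompletion K (ratChar u) (placeOfM D u (x₀ u)) (natCast_mem_placeOfM D (ratChar u) u (natCast_ratChar_mem u) (x₀ u))
  refine (licence_settingPrVolSharpM_tOfIdeleData_iff_orders_of_j_mem_range D hlog r M archPk archSub Ψ act Mmod region n lat sig
    split qData htq0 Sq htq1 x₀ ϖ hϖ Dx hD cin cout hin hmax houtΛ hdom Rin Rout hRin hRout mq hq hj).2 fun u i => ?_
  -- at the member `x₀ u`: abbreviations
  have hp1 : (1 : ℝ) < ((ratChar u : ℕ) : ℝ) := by exact_mod_cast (Fact.out : (ratChar u).Prime).one_lt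
  have hee0 : 0 < absRamificationIdx (ratChar u) (kOfM D (ratChar u) u (natCast_ratChar_mem u) (x₀ u)) := absRamificationIdx_pos _ _
  have hRR : Rout u ≤ Rin u := radius_exponent_le_of_witnesses D u (x₀ u) (hϖ u) (hin u) (hdom u) (hRin u) (hRout u)
  -- `‖ϖ‖^k = p^{-k/e}`
  have hzp : ∀ k : ℤ, ‖(ϖ u : kOfM D (ratChar u) u (natCast_ratChar_mem u) (x₀ u))‖ ^ k =
      ((ratChar u : ℕ) : ℝ) ^ (-((k : ℝ) / (absRamificationIdx (ratChar u) (kOfM D (ratChar u) u (natCast_ratChar_mem u) (x₀ u)) : ℝ))) := by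
    intro k
    rw [norm_eq_rpow_of_isUniformizer (ratChar u) _ (hϖ u), ← Real.rpow_intCast,
      ← Real.rpow_mul (by positivity : (0 : ℝ) ≤ ((ratChar u : ℕ) : ℝ))]
    congr 1; ring
  by_cases hbad : placeModOfM D u (x₀ u) ∈ (ThetaData.pilotData D).S
  · obtain ⟨he, hDd, ⟨z, hz, hzle⟩, ⟨z', hz', hz'le⟩, hq'⟩ := hloc u (x₀ u) hbad
    have hc := hcell u ⟨x₀ u, hbad⟩ i
    have he0 : (0 : ℝ) < (e u : ℝ) := by rw [← he]; exact_mod_cast hee0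
    -- `m_q(u) = P_u`
    have hmq : mq u = (P u : ℤ) := by
      have h1 := hq u
      rw [hq', hzp, he] at h1
      have h2 : -((P u : ℝ) / (e u : ℝ)) = -(((mq u : ℤ) : ℝ) / (e u : ℝ)) := by
        by_contra hne'
        rcases lt_or_gt_of_ne hne' with hlt | hgt
        · exact absurd h1 (ne_of_lt ((Real.rpow_lt_rpow_left_iff hp1).mpr hlt))
        · exact absurd h1 (ne_of_gt ((Real.rpow_lt_rpow_left_iff hp1).mpr hgt))
      have h3 : ((mq u : ℤ) : ℝ) = (P u : ℝ) := by
        have := neg_injective h2; field_simp at this; linarith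
      exact_mod_cast h3
    -- `D_u ≤ D_x`
    have hDx : (Dd u : ℤ) ≤ (Dx u : ℤ) := by
      have h1 := hDd.trans_eq (hD u)
      rw [he] at h1
      have h2 : (Dd u : ℝ) ≤ (Dx u : ℝ) := (div_le_div_iff_of_pos_right he0).mp h1
      exact_mod_cast h2
    -- `ρin_u ≤ R_in(u)`
    have hRin' : ρin u ≤ Rin u := by
      have h1 := norm_inner_le_of_not_mem (ratChar u) (kOfM D (ratChar u) u (natCast_ratChar_mem u) (x₀ u)) (hin u) hz
        (ρ := ρin u) (by rw [he]; exact hzle)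
      rw [hRin u, hzp] at h1
      rw [Real.rpow_le_rpow_left_iff hp1, neg_le_neg_iff] at h1
      have h2 : (ρin u : ℝ) ≤ (Rin u : ℝ) := by
        have hpos : (0 : ℝ) < (absRamificationIdx (ratChar u) (kOfM D (ratChar u) u (natCast_ratChar_mem u) (x₀ u)) : ℝ) := by
          exact_mod_cast hee0
        exact (div_le_div_iff_of_pos_right hpos).mp h1
      exact_mod_cast h2
    -- `R_out(u) ≤ ρout_u`
    have hRout' : Rout u ≤ ρout u := by
      have h1 : ((ratChar u : ℕ) : ℝ) ^ (-((ρout u : ℝ) / (e u : ℝ))) ≤ ‖cout u‖ := hz'le.trans (hdom u z' hz')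
      rw [hRout u, hzp, he] at h1
      rw [Real.rpow_le_rpow_left_iff hp1, neg_le_neg_iff] at h1
      have h2 : (Rout u : ℝ) ≤ (ρout u : ℝ) := (div_le_div_iff_of_pos_right he0).mp h1
      exact_mod_cast h2
    -- the cell, by monotonicity
    rw [he, hmq]
    have heZ : (0 : ℤ) < (e u : ℤ) := by exact_mod_cast (he ▸ hee0)
    have hsq : ((((i : ℕ) + 1) ^ 2 : ℕ) : ℤ) = ((((i : ℕ) + 1 : ℕ) : ℤ)) ^ 2 := by push_cast; ring
    have hnum : (P u : ℤ) * ((((i : ℕ) + 1) ^ 2 : ℕ) : ℤ) - (((i : ℕ) + 1 : ℕ) : ℤ) * (Dx u : ℤ) - (((i : ℕ) + 2 : ℕ) : ℤ) * Rin u ≤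
        ((((i : ℕ) + 1 : ℕ) : ℤ)) ^ 2 * (P u : ℤ) - (((i : ℕ) + 1 : ℕ) : ℤ) * (Dd u : ℤ) - (((i : ℕ) + 2 : ℕ) : ℤ) * ρin u := by
      rw [hsq]
      have h1 : (0 : ℤ) ≤ (((i : ℕ) + 1 : ℕ) : ℤ) := by positivity
      have h2 : (0 : ℤ) ≤ (((i : ℕ) + 2 : ℕ) : ℤ) := by positivity
      nlinarith [mul_le_mul_of_nonneg_left hDx h1, mul_le_mul_of_nonneg_left hRin' h2]
    have hdiv := Int.ediv_le_ediv heZ hnum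
    have h3 : (0 : ℤ) ≤ (((i : ℕ) + 2 : ℕ) : ℤ) := by positivity
    have h4 := mul_le_mul_of_nonneg_left hRout' h3
    have h5 := mul_le_mul_of_nonneg_left hdiv heZ.le
    linarith
  · -- a member off `V^bad_mod`: `‖t_q‖ = 1`, `m_q = 0`, predicate automatic
    have h1 : ‖tqM D (ratChar u) u (natCast_ratChar_mem u) r (x₀ u)‖ = 1 :=
      norm_tqM_eq_one_of_not_mem D (ratChar u) u (natCast_ratChar_mem u) r (x₀ u) hbad
    have hmq0 : mq u = 0 := by
      have h2 := hq u
      rw [h1] at h2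
      exact (zpow_eq_one_iff_right₀ (norm_nonneg _) (hϖ u).1.ne).mp h2.symm
    rw [hmq0, zero_mul]
    have key := orders_predicate_of_exponents_zero
      (e := (absRamificationIdx (ratChar u) (kOfM D (ratChar u) u (natCast_ratChar_mem u) (x₀ u)) : ℤ))
      (by exact_mod_cast hee0) (Dx := (Dx u : ℤ)) (by positivity) hRR ((i : ℕ) + 1)
    have e1 : ((((i : ℕ) + 1 : ℕ) : ℕ) : ℤ) = ((((i : ℕ) + 1 : ℕ)) : ℤ) := rfl
    push_cast at key ⊢
    have e2 : ((i : ℤ) + 1 + 1) = ((i : ℤ) + 2) := by ring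
    rw [e2] at key
    exact key

end Own

end Summit.ABC.IUTFork.Conditional

end
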